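import Mathlib
import Summits.KontsevichZagierPeriods.Zeta5Search.SecondOrderLive
import HarnessLib

/-!
# ζ(5) search — THEOREM A‴, aggregation: `W/(−p)^{m+3} ≡ −pα τ_W(T)`, `V/(−p)^m ≡ −pα τ_V(T) (mod p²)` under the hypotheses of `LawA3`

Cell `pub-zeta5` (HONEST FRAMING: systematic search; no irrationality claim unless certified), typer seat generation 11.
REPORT-gen2-g10 §3 (proof of THEOREM A‴), for ONE parameter vector `b` satisfying the class hypotheses of `SecondOrder.LawA3`
(`m = −M` even `≤ −6`; deep classes non-self-conjugate of the palindromic type `T`; sub-deep classes single raises of `T` or the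
odd-centre class of type `T`): the normalised ζ(3)-coefficient and constant term are, modulo `p²`, the SAME multiple `−pα` of the
direction `τ(T) = (τ_W(T), τ_V(T))` (`aggregate`), with
`α = ½(Σ_{deep x} ĝ_xφ_x + Σ_{sub-deep y} c_y)`.  Ingredients: the class decomposition `W = Σ_x W_x`, `V = Σ_x V_x`; the normalised
class digits (`SecondOrderPair`); `ŵ_x = 0`, `τ(x) = τ(T)` and `v̂_x̄ = v̂_x` on deep classes with the pair weight
`ĝ_x + ĝ_x̄ ≡ L_x pφ_xĝ_x` (`deep_data`, `gHat_pair_second`); the orbit identity `σ_y + σ_ȳ = τ(T)` on live sub-deep classes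
(`live_pair`) and the vanishing of tame digits; the conjugation involution on the deep and sub-deep residues.
Nothing here bears on irrationality.
-/

noncomputable section

open Finset PowerSeries

namespace Summit.KontsevichZagierPeriods.Zeta5Search.SecondOrder

open Summit.KontsevichZagierPeriods.Zeta5Search.DualSeries (InBox)
open Summit.KontsevichZagierPeriods.Zeta5Search.WedgeDictionary (coeffW coeffV)
open Summit.KontsevichZagierPeriods.Zeta5Search.CasoratianValuation (InPolytope)
open Summit.KontsevichZagierPeriods.Zeta5Search.ClusterValuation
open Summit.KontsevichZagierPeriods.Zeta5Search.PadicSeries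
open Summit.KontsevichZagierPeriods.Zeta5Search.CellA (classW coeffW_eq_sum_classW padicNorm_p)
open Literature.NumberTheory.Transcendental.BallRivoal (harm)

variable {p : ℕ} [hp : Fact p.Prime]

/-! ## §1 `ν_x` versus `E_x` -/

omit hp in
/-- If `ν_x ≠ E_x` the class is a tame single-pole class and `ν_x = max(E_x, 0) ≥ 0`. -/
theorem tame_of_classNu_ne (b : ℕ → ℤ) {p x : ℕ} (h : classNu b p x ≠ classExp b p x) :
    classPoleCount b p x = 1 ∧ 0 ≤ classNu b p x := by
  by_cases ht : classPoleCount b p x = 1 ∧ tameSingle b p x = true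
  · refine ⟨ht.1, ?_⟩
    unfold classNu; rw [if_pos ht]; exact le_max_right _ _
  · exfalso; apply h; unfold classNu; rw [if_neg ht]

/-! ## §2 The conjugation involution on residues -/

section Conj

variable (b : ℕ → ℤ) (h0 : 0 ≤ b 0) (hp0 : 0 < p) (hpn : p ≤ (b 0).toNat)
include h0 hp0 hpn

omit hp h0 hp0 in
/-- A conjugation-invariant set of residues: sums are symmetrised, `2Σ F = Σ (F y + F ȳ)`. -/
theorem sum_conj_symm (K : Finset ℕ) (hKp : ∀ y ∈ K, y < p) (hK : ∀ y ∈ K, conjClass b p y ∈ K) (F : ℕ → ℚ) :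
    2 * ∑ y ∈ K, F y = ∑ y ∈ K, (F y + F (conjClass b p y)) := by
  have hinv : ∀ y ∈ K, conjClass b p (conjClass b p y) = y := fun y hy => conjClass_conjClass b (hKp y hy) hpn
  have hflip : ∑ y ∈ K, F (conjClass b p y) = ∑ y ∈ K, F y :=
    sum_nbij' (conjClass b p) (conjClass b p) hK hK hinv hinv (fun _ _ => rfl)
  rw [sum_add_distrib, hflip, two_mul]

omit hp in
/-- The conjugate of a residue in a set cut out by pole count and class exponent stays in the set. -/
theorem conj_mem_filter {P : ℕ → ℤ → Prop} [DecidablePred fun x : ℕ => P (classPoleCount b p x) (classExp b p x)] {y : ℕ}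
    (hy : y ∈ (range p).filter fun x => P (classPoleCount b p x) (classExp b p x)) :
    conjClass b p y ∈ (range p).filter fun x => P (classPoleCount b p x) (classExp b p x) := by
  obtain ⟨hyr, hP⟩ := mem_filter.1 hy
  have hy' := mem_range.1 hyr
  have hyn : y ≤ (b 0).toNat := by omega
  refine mem_filter.2 ⟨mem_range.2 (conjClass_lt b hp0 y), ?_⟩
  rwa [classPoleCount_conj b h0 hyn, classExp_conj b h0 hyn]

end Conj

/-! ## §3 The pair coefficient of a sub-deep class -/

/-- The pair coefficient `c_y`: `ĝ_y` if `y` or `ȳ` is live (`ν = −M+1`), else `0`. -/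
def pairCoeff (b : ℕ → ℤ) (p M y : ℕ) : ℚ :=
  if classNu b p y = -(M : ℤ) + 1 ∨ classNu b p (conjClass b p y) = -(M : ℤ) + 1 then gHat b p y else 0

omit hp in
/-- `‖c_y‖ ≤ 1`. -/
theorem padicNorm_pairCoeff_le (b : ℕ → ℤ) (M y : ℕ) (hg : padicNorm p (gHat b p y) ≤ 1) :
    padicNorm p (pairCoeff b p M y) ≤ 1 := by
  unfold pairCoeff; split_ifs
  · exact hg
  · simp

section SubPair

variable (b : ℕ → ℤ) (hb : InPolytope b) (hp5 : 5 ≤ p) (hpn : (p : ℤ) ≤ b 0) (hwin : (b 0 + 2 : ℤ) < (p : ℤ) ^ 2)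
  {M : ℕ} (hM : 6 ≤ M) (hMe : Even M) {T : List ℤ} (hT : T.reverse = T)
  (H4 : ∀ y, y < p → 1 ≤ classPoleCount b p y → classNu b p y = -(M : ℤ) + 1 →
    isRaise T (classTypeList b p y) = true ∨ (¬ (2 : ℤ) ∣ b 0 ∧ CentreIn b p y ∧ classTypeList b p y = T))
include hb hp5 hpn hwin hM hMe hT H4

/-- **The orbit of a sub-deep class is `c_y τ(T)` to first order**: for a pole class `y` of exponent `−M+1`,
`‖ĝ_yŵ_y + ĝ_ȳŵ_ȳ − c_y τ_W(T)‖ ≤ p⁻¹` and `‖ĝ_yv̂_y + ĝ_ȳv̂_ȳ − c_y τ_V(T)‖ ≤ p⁻¹`. -/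
theorem sub_pair_norm {y : ℕ} (hy : y < p) (hpole : 1 ≤ classPoleCount b p y) (hE : classExp b p y = -(M : ℤ) + 1) :
    padicNorm p (gHat b p y * wHat b p y + gHat b p (conjClass b p y) * wHat b p (conjClass b p y)
        - pairCoeff b p M y * typeTauW (tTop T) (tList T)) ≤ (p : ℚ) ^ (-(1 : ℤ)) ∧
      padicNorm p (gHat b p y * vHat b p y + gHat b p (conjClass b p y) * vHat b p (conjClass b p y)
        - pairCoeff b p M y * typeTauV (tTop T) (tList T)) ≤ (p : ℚ) ^ (-(1 : ℤ)) := by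
  have h0 : 0 ≤ b 0 := hb.1.1
  have hp0 : 0 < p := hp.out.pos
  have hp2 : p ≠ 2 := by omega
  obtain ⟨-, -, -, hn⟩ := thmA_data b hb hwin
  have hpn' : p ≤ (b 0).toNat := by have := hb.1.1; omega
  have hyn : y ≤ (b 0).toNat := le_b0_of_lt b hpn hy
  have hneg : classExp b p y < 0 := by omega
  obtain ⟨hL, hL'⟩ := level_bounds' (p := p) b hyn
  set yc := conjClass b p y with hyc
  have hyc' : yc < p := conjClass_lt b hp0 y
  have hycn : yc ≤ (b 0).toNat := le_b0_of_lt b hpn hyc'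
  have hEc : classExp b p yc = -(M : ℤ) + 1 := by rw [hyc, classExp_conj b h0 hyn]; exact hE
  have hpolec : 1 ≤ classPoleCount b p yc := by rw [hyc, classPoleCount_conj b h0 hyn]; exact hpole
  have hcc : conjClass b p yc = y := conjClass_conjClass b hy hpn'
  -- integrality of the digits of the conjugate
  have hw1 : ∀ z, padicNorm p (wHat b p z) ≤ 1 := fun z => LevelClass.padicNorm_wHat_le_one b h0 hn hp2 z
  have hv1 : ∀ z, padicNorm p (vHat b p z) ≤ 1 := fun z => LevelClass.padicNorm_vHat_le_one b h0 hn hp2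
  -- `ĝ_ȳ ≡ ĝ_y`
  have hgg : padicNorm p (gHat b p yc - gHat b p y) ≤ (p : ℚ) ^ (-(1 : ℤ)) := by
    by_cases hc : CentreIn b p y
    · rw [hyc, (centreIn_iff_conjClass_eq b hpn' hy).1 hc, sub_self, padicNorm.zero]; exact zpow_p_nonneg _
    · have hodd : Odd (classExp b p y) := by
        rw [hE]; obtain ⟨r, hr⟩ := hMe; exact ⟨-(r : ℤ), by omega⟩
      exact gHat_pair_first b hb hp5 hy hL hL' hc hodd
  -- the live identity for the pair, from either side
  have key : ∀ {z : ℕ} (hz : z < p) (hzp : 1 ≤ classPoleCount b p z) (hzE : classExp b p z = -(M : ℤ) + 1),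
      classNu b p z = -(M : ℤ) + 1 →
      wHat b p z + wHat b p (conjClass b p z) = typeTauW (tTop T) (tList T) ∧
        vHat b p z + vHat b p (conjClass b p z) = typeTauV (tTop T) (tList T) :=
    fun hz hzp hzE hnu => live_pair b hb hpn hT hz hzp (by omega) (H4 _ hz hzp hnu)
  by_cases hlive : classNu b p y = -(M : ℤ) + 1 ∨ classNu b p yc = -(M : ℤ) + 1
  · have hc : pairCoeff b p M y = gHat b p y := by unfold pairCoeff; rw [if_pos hlive]
    -- the pair identity `σ_y + σ_ȳ = τ`
    have hpair : wHat b p y + wHat b p yc = typeTauW (tTop T) (tList T) ∧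
        vHat b p y + vHat b p yc = typeTauV (tTop T) (tList T) := by
      rcases hlive with h | h
      · exact key hy hpole hE h
      · have := key hyc' hpolec hEc h
        rw [hcc] at this
        exact ⟨by rw [add_comm]; exact this.1, by rw [add_comm]; exact this.2⟩
    rw [hc, ← hpair.1, ← hpair.2]
    have eW : gHat b p y * wHat b p y + gHat b p yc * wHat b p yc - gHat b p y * (wHat b p y + wHat b p yc) =
        (gHat b p yc - gHat b p y) * wHat b p yc := by ring
    have eV : gHat b p y * vHat b p y + gHat b p yc * vHat b p yc - gHat b p y * (vHat b p y + vHat b p yc) =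
        (gHat b p yc - gHat b p y) * vHat b p yc := by ring
    rw [eW, eV, padicNorm.mul, padicNorm.mul]
    exact ⟨by calc _ ≤ (p : ℚ) ^ (-(1 : ℤ)) * 1 := mul_le_mul hgg (hw1 _) (padicNorm.nonneg _) (zpow_p_nonneg _)
               _ = _ := mul_one _,
           by calc _ ≤ (p : ℚ) ^ (-(1 : ℤ)) * 1 := mul_le_mul hgg (hv1 _) (padicNorm.nonneg _) (zpow_p_nonneg _)
               _ = _ := mul_one _⟩
  · -- both tame: no digit
    have hc : pairCoeff b p M y = 0 := by unfold pairCoeff; rw [if_neg hlive]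
    push Not at hlive
    obtain ⟨h1, h0y⟩ := tame_of_classNu_ne b (p := p) (x := y) (by rw [hE]; exact hlive.1)
    obtain ⟨h1c, h0c⟩ := tame_of_classNu_ne b (p := p) (x := yc) (by rw [hEc]; exact hlive.2)
    obtain ⟨hwy, hvy⟩ := tame_digits_norm b hb hp5 hwin hy h1 (by omega) h0y
    obtain ⟨hwc, hvc⟩ := tame_digits_norm b hb hp5 hwin hyc' h1c (by omega) h0c
    rw [hc, zero_mul, sub_zero, zero_mul, sub_zero]
    exact ⟨(padicNorm.nonarchimedean (p := p)).trans (max_le hwy hwc),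
      (padicNorm.nonarchimedean (p := p)).trans (max_le hvy hvc)⟩

end SubPair

end Summit.KontsevichZagierPeriods.Zeta5Search.SecondOrder

end
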